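import Mathlib
import Summits.Ventures.HodgeRepro2.T5ConductorDualLattice
import Summits.Ventures.HodgeRepro2.T5SplitHermitianClass

/-!
# `𝒪_w^n × 𝒪_w^n` IS `ψ`-SELF-DUAL AT A SPLIT PLACE (the swap star on `F × F`)

Tier-5 support N3 / §G-N4.2 (seat p3, gen 84). File 329 proved that the standard lattice is self-dual FOR THE
CHARACTER at every good non-split place. At a SPLIT place the record's local algebra is `K_w × K_w` with the swap
involution (file 131's `swapStarRing`), the Gram matrix is the pair `(H_w, H_wᵀ)` (`pairMatrix`, file 225's
`tensorGram_map_splitEquiv`) and the lattice is `𝒪_w^n × 𝒪_w^n` (file 229's `image_splitEquiv_tensorLattice`). The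
pairing `⟨x, y⟩_{(A, B)} = (x₂ ⬝ᵥ A y₁, x₁ ⬝ᵥ B y₂)` is composed with the trace `(a, b) ↦ a + b` of `F × F` over `F`,
so the character is `ψ_E(a, b) = ψ(a) ψ(b)`. This file proves the split-place self-duality on any valued field:

* **`val_vecMul_le_one`** — an integral vector times an integral matrix is integral;
  **`forall_val_vecMul_le_one_iff`** — for `A A' = 1` with `A, A'` integral: `c ᵥ* A` integral `⟺` `c` integral;
* **`forall_dotProduct_mulVec_eq_one_iff`** — for `ψ` of conductor exponent `0`: `ψ(c ⬝ᵥ A y) = 1` for every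
  integral `y` `⟺` `c` integral (file 329's `forall_dotProduct_eq_one_iff` on `c ᵥ* A`);
* **`sesqForm_pairMatrix_fst`** / **`…_snd`** — the two components of `⟨x, y⟩_{(A, B)}` for the swap star;
* **`forall_addChar_pair_iff_forall_val_le_one`** — THE SPLIT SELF-DUALITY: for `A A' = 1`, `B B' = 1`, all four
  integral, and `ψ` of conductor exponent `0`: `ψ(⟨x, y⟩_{(A,B)}.1) · ψ(⟨x, y⟩_{(A,B)}.2) = 1` for every
  `y ∈ 𝒪^n × 𝒪^n` `⟺` `x ∈ 𝒪^n × 𝒪^n`;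
* **`forall_recordChar_pair_iff_forall_val_le_one`** — THE RECORD: `K` a CM field, `v` a place of `K⁺` with
  `disc K ∉ v` above `v_p`, `w ∣ v`, `H` over `K` with `det H` a unit and `w ∉ badSet H`, `ψ : ℚ_p → S¹` continuous
  non-trivial of conductor exponent `0`: `𝒪_w^n × 𝒪_w^n` is self-dual for `ψ_w = ψ ∘ Tr ∘ Tr` and `(H_w, H_wᵀ)`.

Nothing here is a statement about (P), theta lifts or L-values. §8(d): uses an L-value-free non-vanishing
device: NO.
-/

open IsDedekindDomain IsDedekindDomain.HeightOneSpectrum NumberField Matrix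
open Summit.Ventures.HodgeRepro2.T5AdditiveConductor Summit.Ventures.HodgeRepro2.T5UnitaryGroupIsometry
  Summit.Ventures.HodgeRepro2.T5ConductorDualBall Summit.Ventures.HodgeRepro2.T5ConductorDualLattice
  Summit.Ventures.HodgeRepro2.T5GlobalLatticeAlmostAll Summit.Ventures.HodgeRepro2.T5SplitHermitianClass

namespace Summit.Ventures.HodgeRepro2.T5ConductorDualLatticeSplit

section Integral

variable {F : Type*} [Field F] (v : Valuation F (WithZero (Multiplicative ℤ)))
variable {ι : Type*} [Fintype ι] [DecidableEq ι]

omit [DecidableEq ι] in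
/-- **An integral vector times an integral matrix is integral** (`Valuation.map_sum_le`). -/
theorem val_vecMul_le_one {c : ι → F} (hc : ∀ i, v (c i) ≤ 1) {A : Matrix ι ι F} (hA : ∀ i j, v (A i j) ≤ 1)
    (j : ι) : v ((vecMul c A) j) ≤ 1 := by
  unfold vecMul dotProduct
  apply Valuation.map_sum_le
  intro i _
  rw [map_mul]
  exact mul_le_one' (hc i) (hA i j)

/-- **`c ᵥ* A` is integral iff `c` is**, for `A A' = 1` with `A` and `A'` integral (`c = (c ᵥ* A) ᵥ* A'`). -/
theorem forall_val_vecMul_le_one_iff {A A' : Matrix ι ι F} (hAA' : A * A' = 1) (hA : ∀ i j, v (A i j) ≤ 1)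
    (hA' : ∀ i j, v (A' i j) ≤ 1) (c : ι → F) :
    (∀ j, v ((vecMul c A) j) ≤ 1) ↔ ∀ i, v (c i) ≤ 1 := by
  constructor
  · intro h i
    have : c = vecMul (vecMul c A) A' := by rw [vecMul_vecMul, hAA', vecMul_one]
    rw [this]
    exact val_vecMul_le_one v h hA' i
  · intro hc j
    exact val_vecMul_le_one v hc hA j

end Integral

section Character

variable {F : Type*} {M : Type*} [Field F] [CommMonoid M]
variable (ψ : AddChar F M) (v : Valuation F (WithZero (Multiplicative ℤ)))
variable (hb : ∃ k : ℤ, ∀ x, v x ≤ WithZero.exp k → ψ x = 1) (hne : ∃ x, ψ x ≠ 1)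
variable {ι : Type*} [Fintype ι] [DecidableEq ι]

include hb hne in
/-- **`ψ(c ⬝ᵥ A y) = 1` for every integral `y` iff `c` is integral**, for `A A' = 1` with `A, A'` integral and `ψ`
of conductor exponent `0` (file 329's `forall_dotProduct_eq_one_iff` on `c ᵥ* A`, `Matrix.dotProduct_mulVec`). -/
theorem forall_dotProduct_mulVec_eq_one_iff (h0 : conductorExp ψ v = 0) {A A' : Matrix ι ι F} (hAA' : A * A' = 1)
    (hA : ∀ i j, v (A i j) ≤ 1) (hA' : ∀ i j, v (A' i j) ≤ 1) (c : ι → F) :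
    (∀ y : ι → F, (∀ i, v (y i) ≤ 1) → ψ (c ⬝ᵥ (A *ᵥ y)) = 1) ↔ ∀ i, v (c i) ≤ 1 := by
  rw [← forall_val_vecMul_le_one_iff v hAA' hA hA' c,
    ← forall_dotProduct_eq_one_iff ψ v hb hne h0 (vecMul c A)]
  simp only [dotProduct_mulVec]

end Character

section Split

variable {F : Type*} [CommRing F] {ι : Type*} [Fintype ι]

/-- `A *ᵥ (fun _ => 0) = 0` (`Matrix.mulVec_zero` with the zero vector written as a constant function). -/
theorem mulVec_fun_zero (A : Matrix ι ι F) : A *ᵥ (fun _ : ι => (0 : F)) = 0 := mulVec_zero A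

/-- The first component of `⟨x, y⟩_{(A, B)}` for the swap star: `x₂ ⬝ᵥ (A *ᵥ y₁)`. -/
theorem sesqForm_pairMatrix_fst (A B : Matrix ι ι F) (x y : ι → F × F) :
    letI := swapStarRing F
    (sesqForm (pairMatrix A B) x y).1 = (fun i => (x i).2) ⬝ᵥ (A *ᵥ fun j => (y j).1) := by
  letI := swapStarRing F
  rw [sesqForm_apply, Prod.fst_sum]
  unfold dotProduct mulVec
  simp only [dotProduct]
  refine Finset.sum_congr rfl fun i _ => ?_
  rw [Prod.fst_sum, Finset.mul_sum]
  refine Finset.sum_congr rfl fun j _ => ?_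
  rw [swap_star_apply, pairMatrix, Matrix.of_apply, Prod.fst_mul, Prod.fst_mul]

/-- The second component of `⟨x, y⟩_{(A, B)}` for the swap star: `x₁ ⬝ᵥ (B *ᵥ y₂)`. -/
theorem sesqForm_pairMatrix_snd (A B : Matrix ι ι F) (x y : ι → F × F) :
    letI := swapStarRing F
    (sesqForm (pairMatrix A B) x y).2 = (fun i => (x i).1) ⬝ᵥ (B *ᵥ fun j => (y j).2) := by
  letI := swapStarRing F
  rw [sesqForm_apply, Prod.snd_sum]
  unfold dotProduct mulVec
  simp only [dotProduct]
  refine Finset.sum_congr rfl fun i _ => ?_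
  rw [Prod.snd_sum, Finset.mul_sum]
  refine Finset.sum_congr rfl fun j _ => ?_
  rw [swap_star_apply, pairMatrix, Matrix.of_apply, Prod.snd_mul, Prod.snd_mul]

end Split

section SplitDual

variable {F : Type*} {M : Type*} [Field F] [CommMonoid M]
variable (ψ : AddChar F M) (v : Valuation F (WithZero (Multiplicative ℤ)))
variable (hb : ∃ k : ℤ, ∀ x, v x ≤ WithZero.exp k → ψ x = 1) (hne : ∃ x, ψ x ≠ 1)
variable {ι : Type*} [Fintype ι] [DecidableEq ι]

include hb hne in
/-- **THE SPLIT SELF-DUALITY**: for `A A' = 1`, `B B' = 1` with all four matrices integral and `ψ` of conductor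
exponent `0`, `ψ(⟨x, y⟩_{(A,B)}.1) · ψ(⟨x, y⟩_{(A,B)}.2) = 1` for every `y ∈ 𝒪^n × 𝒪^n` iff `x ∈ 𝒪^n × 𝒪^n`
(the swap star; `y = (y₁, 0)` and `y = (0, y₂)` separate the two components). -/
theorem forall_addChar_pair_iff_forall_val_le_one (h0 : conductorExp ψ v = 0)
    {A A' B B' : Matrix ι ι F} (hAA' : A * A' = 1) (hBB' : B * B' = 1)
    (hA : ∀ i j, v (A i j) ≤ 1) (hA' : ∀ i j, v (A' i j) ≤ 1)
    (hB : ∀ i j, v (B i j) ≤ 1) (hB' : ∀ i j, v (B' i j) ≤ 1) (x : ι → F × F) :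
    letI := swapStarRing F
    (∀ y : ι → F × F, (∀ i, v (y i).1 ≤ 1 ∧ v (y i).2 ≤ 1) →
      ψ (sesqForm (pairMatrix A B) x y).1 * ψ (sesqForm (pairMatrix A B) x y).2 = 1) ↔
      ∀ i, v (x i).1 ≤ 1 ∧ v (x i).2 ≤ 1 := by
  letI := swapStarRing F
  have hA2 := forall_dotProduct_mulVec_eq_one_iff ψ v hb hne h0 hAA' hA hA' (fun i => (x i).2)
  have hB1 := forall_dotProduct_mulVec_eq_one_iff ψ v hb hne h0 hBB' hB hB' (fun i => (x i).1)
  constructor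
  · intro h
    have h1 : ∀ i, v (x i).1 ≤ 1 := by
      rw [← hB1]
      intro y₂ hy₂
      have := h (fun i => (0, y₂ i)) (fun i => ⟨by simp, hy₂ i⟩)
      rw [sesqForm_pairMatrix_fst, sesqForm_pairMatrix_snd] at this
      simpa only [mulVec_fun_zero, dotProduct_zero, AddChar.map_zero_eq_one, one_mul] using this
    have h2 : ∀ i, v (x i).2 ≤ 1 := by
      rw [← hA2]
      intro y₁ hy₁
      have := h (fun i => (y₁ i, 0)) (fun i => ⟨hy₁ i, by simp⟩)
      rw [sesqForm_pairMatrix_fst, sesqForm_pairMatrix_snd] at this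
      simpa only [mulVec_fun_zero, dotProduct_zero, AddChar.map_zero_eq_one, mul_one] using this
    exact fun i => ⟨h1 i, h2 i⟩
  · intro hx y hy
    rw [sesqForm_pairMatrix_fst, sesqForm_pairMatrix_snd,
      hA2.mpr (fun i => (hx i).2) _ (fun i => (hy i).1), hB1.mpr (fun i => (hx i).1) _ (fun i => (hy i).2),
      one_mul]

end SplitDual

section Record

variable (K : Type*) [Field K] [NumberField K]
variable (vp : HeightOneSpectrum (𝓞 ℚ)) (v : HeightOneSpectrum (𝓞 (maximalRealSubfield K)))
  [hv : v.asIdeal.LiesOver vp.asIdeal] (w : HeightOneSpectrum (𝓞 K)) [hw : w.asIdeal.LiesOver v.asIdeal]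
variable {ι : Type*} [Fintype ι] [DecidableEq ι]

/-- `H_w` and `(H⁻¹)_w` are integral at `w ∉ badSet H` (this seat's `isInteger_of_notMem_badSet`), as valuations. -/
theorem val_map_le_one_of_notMem_badSet {H : Matrix ι ι K} (hw' : w ∉ badSet H) (i j : ι) :
    Valued.v ((H.map (algebraMap K (w.adicCompletion K))) i j) ≤ 1 :=
  (isInteger_adicCompletionIntegers_iff w _).mp (by
    simpa only [Matrix.map_apply] using isInteger_of_notMem_badSet hw' i j)

/-- `(H⁻¹)_w` is integral at `w ∉ badSet H`, as valuations. -/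
theorem val_map_inv_le_one_of_notMem_badSet {H : Matrix ι ι K} (hw' : w ∉ badSet H) (i j : ι) :
    Valued.v ((H⁻¹.map (algebraMap K (w.adicCompletion K))) i j) ≤ 1 :=
  (isInteger_adicCompletionIntegers_iff w _).mp (by
    simpa only [Matrix.map_apply] using isInteger_inv_of_notMem_badSet hw' i j)

include hv hw in
/-- **THE RECORD AT A SPLIT PLACE — `𝒪_w^n × 𝒪_w^n` IS SELF-DUAL FOR `ψ_w` AND `(H_w, H_wᵀ)`**: `K` a CM field, `v` a
place of `K⁺` with `disc K ∉ v` above `v_p`, `w ∣ v`, `H` over `K` with `det H` a unit and `w ∉ badSet H` (so `H_w`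
and `(H⁻¹)_w` are integral and inverse to each other), `ψ : ℚ_p → S¹` continuous non-trivial of conductor
exponent `0`: with `ψ_w = ψ ∘ Tr_{K⁺_v/ℚ_p} ∘ Tr_{K_w/K⁺_v}` (file 329, conductor exponent `0`),
`ψ_w(⟨x, y⟩.1) ψ_w(⟨x, y⟩.2) = 1` for every `y ∈ 𝒪_w^n × 𝒪_w^n` iff `x ∈ 𝒪_w^n × 𝒪_w^n`. -/
theorem forall_recordChar_pair_iff_forall_val_le_one
    (h : ((discr K : ℤ) : 𝓞 (maximalRealSubfield K)) ∉ v.asIdeal)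
    {H : Matrix ι ι K} (hdet : IsUnit H.det) (hw' : w ∉ badSet H)
    (ψ : AddChar (vp.adicCompletion ℚ) Circle) (hψ : Continuous ψ) (hne : ∃ y, ψ y ≠ 1)
    (h0 : conductorExp ψ (Valued.v : Valuation (vp.adicCompletion ℚ) (WithZero (Multiplicative ℤ))) = 0)
    (x : ι → w.adicCompletion K × w.adicCompletion K) :
    letI := swapStarRing (w.adicCompletion K)
    (∀ y : ι → w.adicCompletion K × w.adicCompletion K,
      (∀ i, Valued.v (y i).1 ≤ 1 ∧ Valued.v (y i).2 ≤ 1) →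
      recordChar K vp v w ψ
          (sesqForm (pairMatrix (H.map (algebraMap K (w.adicCompletion K)))
            (H.map (algebraMap K (w.adicCompletion K)))ᵀ) x y).1 *
        recordChar K vp v w ψ
          (sesqForm (pairMatrix (H.map (algebraMap K (w.adicCompletion K)))
            (H.map (algebraMap K (w.adicCompletion K)))ᵀ) x y).2 = 1) ↔
      ∀ i, Valued.v (x i).1 ≤ 1 ∧ Valued.v (x i).2 ≤ 1 := by
  letI := swapStarRing (w.adicCompletion K)
  have hψw : Continuous (recordChar K vp v w ψ) := continuous_recordChar K vp v w ψ hψ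
  have hb : ∃ k : ℤ, ∀ z, Valued.v z ≤ WithZero.exp k → recordChar K vp v w ψ z = 1 :=
    exists_forall_le_exp_of_continuous _ hψw
  have hAA' : H.map (algebraMap K (w.adicCompletion K)) * H⁻¹.map (algebraMap K (w.adicCompletion K)) = 1 :=
    map_mul_map_inv_eq_one hdet w
  have hBB' : (H.map (algebraMap K (w.adicCompletion K)))ᵀ * (H⁻¹.map (algebraMap K (w.adicCompletion K)))ᵀ = 1 := by
    rw [← transpose_mul, ← Matrix.map_mul, Matrix.nonsing_inv_mul H hdet]
    rw [Matrix.map_one _ (map_zero _) (map_one _), transpose_one]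
  exact forall_addChar_pair_iff_forall_val_le_one (recordChar K vp v w ψ) Valued.v hb
    (exists_recordChar_ne_one K vp v w ψ hne) (conductorExp_recordChar_eq_zero K vp v w h ψ hψ hne h0)
    hAA' hBB' (val_map_le_one_of_notMem_badSet K w hw') (val_map_inv_le_one_of_notMem_badSet K w hw')
    (fun i j => val_map_le_one_of_notMem_badSet K w hw' j i)
    (fun i j => val_map_inv_le_one_of_notMem_badSet K w hw' j i) x

end Record

end Summit.Ventures.HodgeRepro2.T5ConductorDualLatticeSplit
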